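import Summits.QuantumFields.YangMills.Theorems.BalabanUVNodesN22W1StripLemma3

/-!
# BalabanUVNodes ∕ node N22 = NE9 — THE STRIP INDUCTION AT THE W1 OBJECT, MODULE 8: THE MIXED PRODUCER AT LEVEL T — (2.15)–(2.26) per term on the strip for the
# OLDER couplings (inherited through the old terms, [II] (2.15) p. 15) + an OUTPUT-level strip letter for the LAST coupling (node N09's `EHoloAt` lane, [I] p. 266–267),
# so that the two unprinted ingredients of different KIND are displayed SEPARATELY at the finest printed level

Cell `pub-ymgap`, HUMAN RULING D-0062 (Track A), R134 ACCELERATION re-seat `pub-ymgap-dag-n22-c` (strategy s1), generation 2, module 8.  THEOREMS ONLY; imports module 3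
`…N22W1StripLemma3` (p465262: `strip_succ_of_termwise226Strip`, and through it modules 1–2: `stripBound_termC_of_stepOut`, `termBound118_of_stripBound`,
`supLetter_functionalOn_of_stripBound`).  `--supports` K3′ (helper).

WHY.  Module 3's level-T one-step hypothesis `h226T` asks, for EVERY coupling `i ≤ k` of step `k`, complexified (2.14) term values obeying (2.26) on the strip.  For an
OLDER coupling `i < k` this is INHERITED: `g_i` enters the step-`k` term only through the old terms `E^{(j)}`, `i < j ≤ k` ([I] p. 256; [II] (2.15) p. 15 «|V_k(Y, B)|»), so
print's (2.15)–(2.26) run verbatim with the old terms' strip extensions (inspection-level).  For the LAST coupling `i = k` it is NOT inherited: `g_k` enters the Gaussian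
integrals, the characteristic functions and the cut-off of (2.14) themselves, and its holomorphy is the [I] p. 266–267 dilation ∕ `g`-free cut-off content — node N09's
per-step delivery `B12BetaHolo.EHoloAt`, an OUTPUT-level letter (dag-n22-d's `…N22LastCouplingHolo`).  Module 2 separated the two at the resummed level (`hprop`);
THIS FILE separates them at level T: older couplings by (2.26) per term on the strip, the last coupling by an output-level STRIP(k+1, k) letter — the honest split of
N22's unprinted content into «N10's lane, inspection-level» and «N09's lane, [H-dil]».

WHAT (STRIP(j, i; E₀, κ) as in module 1).
* §1 `stepOut_of_termwise226StripOlder_lastOut` — `h226TOlder` (level T for `i < k` only) + `hlast` (STRIP(k+1, k) at output level, given STRIP at the levels `≤ k` in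
  coupling `k` — constant extensions, always available) + the socket numerals + S25's clauses + the renewal ⟹ module 1's one-step output hypothesis.
* §2 END TO END: `stripBound_termC_of_termwise226StripOlder_lastOut` (STRIP everywhere), `termBound118_of_termwise226StripOlder_lastOut` ((1.18) one run),
  `supLetter_functionalOn_of_termwise226StripOlder_lastOut` (ROAD 3's (A) letter `E₀·1^{age}·e^{−κd}` for the W1 functional).

HONEST FRAMING.  Count-neutral by-name knit AT THE OBJECT; NOT a discharge of N22.  `h226TOlder` and `hlast` are DISPLAYED and asserted nowhere (the former NOT PRINTED on the
strip — inspection-level; the latter = N09's `EHoloAt` content, whose instance at W1's `termC` needs the record's identification of N09's `SFTower.E (k+1) X t φ` with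
`W1.termC S (k+1) X (g|g_k:=t) φ` — definer lane, not here).  One finite four-torus programme at fixed ε — NOT infinite volume, NOT OS on ℝ⁴, NOT a mass gap, NOT Clay.
0 `sorry`, 0 `def`, standard axioms.

References (TYPES only): [I] = [Balaban1987RG1] §0 p. 256, (1.18) p. 263, p. 266–267; [II] = [Balaban1988RG2Cluster] (2.14)–(2.15) p. 15, (2.26) p. 17, Lemma 3 p. 20.
-/

noncomputable section

namespace YMDAG.N22.W1

open Set Metric
open scoped BigOperators
open Literature.MathematicalPhysics.QuantumFieldTheory.Balaban1983to89
open Literature.MathematicalPhysics.QuantumFieldTheory.Balaban1983to89.T4Continuum (T4Family)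
open Literature.MathematicalPhysics.QuantumFieldTheory.Balaban1983to89.T4OutputRate
open Literature.MathematicalPhysics.QuantumFieldTheory.Balaban1983to89.TreeLengthTorus (TPt TDom tsys torusTreeLen torusTreeLen_nonneg)
open Literature.MathematicalPhysics.QuantumFieldTheory.Balaban1983to89.B12TreeDecay (K₀ K₀_pos)
open Literature.MathematicalPhysics.QuantumFieldTheory.Balaban1983to89.B13Lemma3TorusData (TBond)
open Literature.MathematicalPhysics.QuantumFieldTheory.Balaban1983to89.B13Lemma3TorusTerms (terms weight)
open Literature.MathematicalPhysics.QuantumFieldTheory.Balaban1983to89.B13Lemma3TorusSocket (Lemma3Numerics)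
open Literature.MathematicalPhysics.QuantumFieldTheory.Balaban1983to89.Node00
open Literature.MathematicalPhysics.QuantumFieldTheory.Balaban1983to89.Node00.Sect2 (domSys domCount CPair ofBackgroundC)
open Literature.MathematicalPhysics.QuantumFieldTheory.Balaban1983to89.Node00.W1

variable (F : T4Family) (K : ℕ) {𝔸 : Type*} {M : ℕ}

/-! ## §1 The mixed producer at level T -/

open Classical in
/-- **THE MIXED PRODUCER AT LEVEL T.**  `h226TOlder`: for every step `k`, window history `g`, OLDER coupling `i < k`, `X ∈ 𝐃_{k+1}`, `φ ∈ sp (k+1) X`: STRIP at the levels `≤ k`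
in coupling `i` ⟹ complexified activities `Hc` dominated by complexified term values `Tt` over print's term set `terms L M Z`, obeying (2.26) per term with the printed
`weight` on the strip, `Hc t = (S k).H (g|g_i:=t)|_{≤k} φ` ([II] (2.15)–(2.26) read on the strip — DISPLAYED; inspection-level for older couplings).  `hlast`: for the
LAST coupling `k`, STRIP at the levels `≤ k` in coupling `k` ⟹ STRIP(k+1, k) at `(g, X, φ)` (node N09's output-level letter — DISPLAYED).  Under the socket's numerics
at `ℓ = ½L`, `L ≥ 8`, S25's clauses at `A := C₃ε₁`, `R := (1−8δ)½Lκ` and the renewal, module 1's one-step output hypothesis follows: `i < k` by module 3's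
`strip_succ_of_termwise226Strip`, `i = k` by `hlast`. [folklore] -/
theorem stepOut_of_termwise226StripOlder_lastOut [NeZero M] (S : ClusterTower (F.P K) 𝔸 M)
    (sp : (j : ℕ) → (domSys (F.P K) M j).Dom → Set (CPair (F.P K) 𝔸)) (c : B13.Consts) {L : ℕ} [NeZero L] (hL : 8 ≤ c.L)
    (hLc : c.L = L) {a a₂ a₂' a₅ Aabs : ℝ} (hN : Lemma3Numerics c M ((c.L : ℝ) / 2) a a₂ a₂' a₅ Aabs)
    {γ r E₀ κ r₁ : ℝ} (hA0 : 0 ≤ c.C3act * c.ε₁) (hr₁ : 0 ≤ r₁) (hκ : κ ≤ r₁)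
    (hrate : r₁ + 2 * (64 * Real.log 162) + 2 ≤ (1 - 8 * c.δ) * ((c.L : ℝ) / 2) * c.κ)
    (hsmall : c.C3act * c.ε₁ * Real.exp (5 * r₁ + 1) * K₀ 64 8 * 9 * 64 ≤ 1)
    (hrenew : Real.exp 1 * 9 * 64 * K₀ 64 8 ^ 2 * (c.C3act * c.ε₁) ≤ E₀)
    (h226TOlder : ∀ (k : ℕ) (g : ℕ → ℝ), g ∈ Window γ → ∀ (i : ℕ), i < k → ∀ (X : (domSys (F.P K) M (k + 1)).Dom) (φ : CPair (F.P K) 𝔸),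
      φ ∈ sp (k + 1) X →
      (∀ (j : ℕ), j < k + 1 → ∀ (Y : (domSys (F.P K) M j).Dom) (ψ : CPair (F.P K) 𝔸), ψ ∈ sp j Y →
        ∃ (Ec : ℂ → ℂ) (O : Set ℂ), IsOpen O ∧ (∀ t ∈ Ioc (0 : ℝ) γ, closedBall (t : ℂ) r ⊆ O) ∧ DifferentiableOn ℂ Ec O ∧
          (∀ z ∈ O, ‖Ec z‖ ≤ E₀ * Real.exp (-(κ * torusTreeLen Y.1))) ∧
          (∀ t ∈ Ioc (0 : ℝ) γ, Ec t = termC S j Y (Function.update g i t) ψ)) →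
      ∃ (Hc : ℂ → TDom 4 (domCount (F.P K) M (k + 1)) → ℂ)
        (Tt : (Z : TDom 4 (domCount (F.P K) M (k + 1))) →
          Finset (TDom 4 (L * domCount (F.P K) M (k + 1))) × Finset (TBond 4 M (L * domCount (F.P K) M (k + 1))) → ℂ → ℂ)
        (O : Set ℂ), IsOpen O ∧ (∀ t ∈ Ioc (0 : ℝ) γ, closedBall (t : ℂ) r ⊆ O) ∧
        (∀ Z : (domSys (F.P K) M (k + 1)).Dom, Z.1 ⊆ X.1 → DifferentiableOn ℂ (fun z => Hc z Z) O) ∧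
        (∀ z ∈ O, ∀ Z : TDom 4 (domCount (F.P K) M (k + 1)), Z.1 ⊆ X.1 → ‖Hc z Z‖ ≤ ∑ t ∈ terms L M Z, ‖Tt Z t z‖) ∧
        (∀ z ∈ O, ∀ Z : TDom 4 (domCount (F.P K) M (k + 1)), Z.1 ⊆ X.1 → ∀ t ∈ terms L M Z,
          ‖Tt Z t z‖ ≤ weight L M c Z a t * Real.exp (a₅ * ((Z.1).card : ℝ))) ∧
        (∀ t ∈ Ioc (0 : ℝ) γ, Hc t = (S k).H (restrictPrefix k (Function.update g i t)) φ))
    (hlast : ∀ (k : ℕ) (g : ℕ → ℝ), g ∈ Window γ → ∀ (X : (domSys (F.P K) M (k + 1)).Dom) (φ : CPair (F.P K) 𝔸), φ ∈ sp (k + 1) X →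
      (∀ (j : ℕ), j < k + 1 → ∀ (Y : (domSys (F.P K) M j).Dom) (ψ : CPair (F.P K) 𝔸), ψ ∈ sp j Y →
        ∃ (Ec : ℂ → ℂ) (O : Set ℂ), IsOpen O ∧ (∀ t ∈ Ioc (0 : ℝ) γ, closedBall (t : ℂ) r ⊆ O) ∧ DifferentiableOn ℂ Ec O ∧
          (∀ z ∈ O, ‖Ec z‖ ≤ E₀ * Real.exp (-(κ * torusTreeLen Y.1))) ∧
          (∀ t ∈ Ioc (0 : ℝ) γ, Ec t = termC S j Y (Function.update g k t) ψ)) →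
      ∃ (Ec : ℂ → ℂ) (O : Set ℂ), IsOpen O ∧ (∀ t ∈ Ioc (0 : ℝ) γ, closedBall (t : ℂ) r ⊆ O) ∧ DifferentiableOn ℂ Ec O ∧
        (∀ z ∈ O, ‖Ec z‖ ≤ E₀ * Real.exp (-(κ * torusTreeLen X.1))) ∧
        (∀ t ∈ Ioc (0 : ℝ) γ, Ec t = termC S (k + 1) X (Function.update g k t) φ)) :
    ∀ (k : ℕ) (g : ℕ → ℝ), g ∈ Window γ → ∀ (i : ℕ), i < k + 1 → ∀ (X : (domSys (F.P K) M (k + 1)).Dom) (φ : CPair (F.P K) 𝔸),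
      φ ∈ sp (k + 1) X →
      (∀ (j : ℕ), j < k + 1 → ∀ (Y : (domSys (F.P K) M j).Dom) (ψ : CPair (F.P K) 𝔸), ψ ∈ sp j Y →
        ∃ (Ec : ℂ → ℂ) (O : Set ℂ), IsOpen O ∧ (∀ t ∈ Ioc (0 : ℝ) γ, closedBall (t : ℂ) r ⊆ O) ∧ DifferentiableOn ℂ Ec O ∧
          (∀ z ∈ O, ‖Ec z‖ ≤ E₀ * Real.exp (-(κ * torusTreeLen Y.1))) ∧
          (∀ t ∈ Ioc (0 : ℝ) γ, Ec t = termC S j Y (Function.update g i t) ψ)) →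
      ∃ (Ec : ℂ → ℂ) (O : Set ℂ), IsOpen O ∧ (∀ t ∈ Ioc (0 : ℝ) γ, closedBall (t : ℂ) r ⊆ O) ∧ DifferentiableOn ℂ Ec O ∧
        (∀ z ∈ O, ‖Ec z‖ ≤ E₀ * Real.exp (-(κ * torusTreeLen X.1))) ∧
        (∀ t ∈ Ioc (0 : ℝ) γ, Ec t = termC S (k + 1) X (Function.update g i t) φ) := by
  intro k g hg i hi X φ hφ hIH
  rcases Nat.lt_succ_iff_lt_or_eq.mp hi with hik | rfl
  · obtain ⟨Hc, Tt, O, hO, hdisc, hhol, hdom, h226, hrepH⟩ := h226TOlder k g hg i hik X φ hφ hIH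
    exact strip_succ_of_termwise226Strip F K S c hL hLc hN hA0 hr₁ hκ hrate hsmall hrenew k g i X φ Hc Tt O hO hdisc hhol hdom h226 hrepH
  · exact hlast i g hg X φ hφ hIH

/-! ## §2 End to end from the mixed level-T hypotheses -/

open Classical in
/-- **MIXED LEVEL T ⟹ STRIP AT EVERY LEVEL IN EVERY COUPLING** (module 1's `stripBound_termC_of_stepOut` on §1). [folklore] -/
theorem stripBound_termC_of_termwise226StripOlder_lastOut [NeZero M] (S : ClusterTower (F.P K) 𝔸 M)
    (sp : (j : ℕ) → (domSys (F.P K) M j).Dom → Set (CPair (F.P K) 𝔸)) (c : B13.Consts) {L : ℕ} [NeZero L] (hL : 8 ≤ c.L)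
    (hLc : c.L = L) {a a₂ a₂' a₅ Aabs : ℝ} (hN : Lemma3Numerics c M ((c.L : ℝ) / 2) a a₂ a₂' a₅ Aabs)
    {γ r E₀ κ r₁ : ℝ} (hr : 0 ≤ r) (hA0 : 0 ≤ c.C3act * c.ε₁) (hr₁ : 0 ≤ r₁) (hκ : κ ≤ r₁)
    (hrate : r₁ + 2 * (64 * Real.log 162) + 2 ≤ (1 - 8 * c.δ) * ((c.L : ℝ) / 2) * c.κ)
    (hsmall : c.C3act * c.ε₁ * Real.exp (5 * r₁ + 1) * K₀ 64 8 * 9 * 64 ≤ 1)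
    (hrenew : Real.exp 1 * 9 * 64 * K₀ 64 8 ^ 2 * (c.C3act * c.ε₁) ≤ E₀)
    (h226TOlder : ∀ (k : ℕ) (g : ℕ → ℝ), g ∈ Window γ → ∀ (i : ℕ), i < k → ∀ (X : (domSys (F.P K) M (k + 1)).Dom) (φ : CPair (F.P K) 𝔸),
      φ ∈ sp (k + 1) X →
      (∀ (j : ℕ), j < k + 1 → ∀ (Y : (domSys (F.P K) M j).Dom) (ψ : CPair (F.P K) 𝔸), ψ ∈ sp j Y →
        ∃ (Ec : ℂ → ℂ) (O : Set ℂ), IsOpen O ∧ (∀ t ∈ Ioc (0 : ℝ) γ, closedBall (t : ℂ) r ⊆ O) ∧ DifferentiableOn ℂ Ec O ∧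
          (∀ z ∈ O, ‖Ec z‖ ≤ E₀ * Real.exp (-(κ * torusTreeLen Y.1))) ∧
          (∀ t ∈ Ioc (0 : ℝ) γ, Ec t = termC S j Y (Function.update g i t) ψ)) →
      ∃ (Hc : ℂ → TDom 4 (domCount (F.P K) M (k + 1)) → ℂ)
        (Tt : (Z : TDom 4 (domCount (F.P K) M (k + 1))) →
          Finset (TDom 4 (L * domCount (F.P K) M (k + 1))) × Finset (TBond 4 M (L * domCount (F.P K) M (k + 1))) → ℂ → ℂ)
        (O : Set ℂ), IsOpen O ∧ (∀ t ∈ Ioc (0 : ℝ) γ, closedBall (t : ℂ) r ⊆ O) ∧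
        (∀ Z : (domSys (F.P K) M (k + 1)).Dom, Z.1 ⊆ X.1 → DifferentiableOn ℂ (fun z => Hc z Z) O) ∧
        (∀ z ∈ O, ∀ Z : TDom 4 (domCount (F.P K) M (k + 1)), Z.1 ⊆ X.1 → ‖Hc z Z‖ ≤ ∑ t ∈ terms L M Z, ‖Tt Z t z‖) ∧
        (∀ z ∈ O, ∀ Z : TDom 4 (domCount (F.P K) M (k + 1)), Z.1 ⊆ X.1 → ∀ t ∈ terms L M Z,
          ‖Tt Z t z‖ ≤ weight L M c Z a t * Real.exp (a₅ * ((Z.1).card : ℝ))) ∧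
        (∀ t ∈ Ioc (0 : ℝ) γ, Hc t = (S k).H (restrictPrefix k (Function.update g i t)) φ))
    (hlast : ∀ (k : ℕ) (g : ℕ → ℝ), g ∈ Window γ → ∀ (X : (domSys (F.P K) M (k + 1)).Dom) (φ : CPair (F.P K) 𝔸), φ ∈ sp (k + 1) X →
      (∀ (j : ℕ), j < k + 1 → ∀ (Y : (domSys (F.P K) M j).Dom) (ψ : CPair (F.P K) 𝔸), ψ ∈ sp j Y →
        ∃ (Ec : ℂ → ℂ) (O : Set ℂ), IsOpen O ∧ (∀ t ∈ Ioc (0 : ℝ) γ, closedBall (t : ℂ) r ⊆ O) ∧ DifferentiableOn ℂ Ec O ∧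
          (∀ z ∈ O, ‖Ec z‖ ≤ E₀ * Real.exp (-(κ * torusTreeLen Y.1))) ∧
          (∀ t ∈ Ioc (0 : ℝ) γ, Ec t = termC S j Y (Function.update g k t) ψ)) →
      ∃ (Ec : ℂ → ℂ) (O : Set ℂ), IsOpen O ∧ (∀ t ∈ Ioc (0 : ℝ) γ, closedBall (t : ℂ) r ⊆ O) ∧ DifferentiableOn ℂ Ec O ∧
        (∀ z ∈ O, ‖Ec z‖ ≤ E₀ * Real.exp (-(κ * torusTreeLen X.1))) ∧
        (∀ t ∈ Ioc (0 : ℝ) γ, Ec t = termC S (k + 1) X (Function.update g k t) φ)) :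
    ∀ (j : ℕ) (g : ℕ → ℝ), g ∈ Window γ → ∀ (i : ℕ) (Y : (domSys (F.P K) M j).Dom) (ψ : CPair (F.P K) 𝔸), ψ ∈ sp j Y →
      ∃ (Ec : ℂ → ℂ) (O : Set ℂ), IsOpen O ∧ (∀ t ∈ Ioc (0 : ℝ) γ, closedBall (t : ℂ) r ⊆ O) ∧ DifferentiableOn ℂ Ec O ∧
        (∀ z ∈ O, ‖Ec z‖ ≤ E₀ * Real.exp (-(κ * torusTreeLen Y.1))) ∧
        (∀ t ∈ Ioc (0 : ℝ) γ, Ec t = termC S j Y (Function.update g i t) ψ) :=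
  have hM : 0 ≤ Real.exp 1 * 9 * 64 * K₀ 64 8 ^ 2 * (c.C3act * c.ε₁) := by positivity
  stripBound_termC_of_stepOut S sp hr (le_trans hM hrenew)
    (stepOut_of_termwise226StripOlder_lastOut F K S sp c hL hLc hN hA0 hr₁ hκ hrate hsmall hrenew h226TOlder hlast)

open Classical in
/-- **MIXED LEVEL T ⟹ (1.18) ONE RUN** (`W1.TermBound118 S (Window γ) sp E₀ κ`). [cite: Balaban1987RG1, (1.18) p.263] -/
theorem termBound118_of_termwise226StripOlder_lastOut [NeZero M] (S : ClusterTower (F.P K) 𝔸 M)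
    (sp : (j : ℕ) → (domSys (F.P K) M j).Dom → Set (CPair (F.P K) 𝔸)) (c : B13.Consts) {L : ℕ} [NeZero L] (hL : 8 ≤ c.L)
    (hLc : c.L = L) {a a₂ a₂' a₅ Aabs : ℝ} (hN : Lemma3Numerics c M ((c.L : ℝ) / 2) a a₂ a₂' a₅ Aabs)
    {γ r E₀ κ r₁ : ℝ} (hr : 0 ≤ r) (hA0 : 0 ≤ c.C3act * c.ε₁) (hr₁ : 0 ≤ r₁) (hκ : κ ≤ r₁)
    (hrate : r₁ + 2 * (64 * Real.log 162) + 2 ≤ (1 - 8 * c.δ) * ((c.L : ℝ) / 2) * c.κ)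
    (hsmall : c.C3act * c.ε₁ * Real.exp (5 * r₁ + 1) * K₀ 64 8 * 9 * 64 ≤ 1)
    (hrenew : Real.exp 1 * 9 * 64 * K₀ 64 8 ^ 2 * (c.C3act * c.ε₁) ≤ E₀)
    (h226TOlder : ∀ (k : ℕ) (g : ℕ → ℝ), g ∈ Window γ → ∀ (i : ℕ), i < k → ∀ (X : (domSys (F.P K) M (k + 1)).Dom) (φ : CPair (F.P K) 𝔸),
      φ ∈ sp (k + 1) X →
      (∀ (j : ℕ), j < k + 1 → ∀ (Y : (domSys (F.P K) M j).Dom) (ψ : CPair (F.P K) 𝔸), ψ ∈ sp j Y →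
        ∃ (Ec : ℂ → ℂ) (O : Set ℂ), IsOpen O ∧ (∀ t ∈ Ioc (0 : ℝ) γ, closedBall (t : ℂ) r ⊆ O) ∧ DifferentiableOn ℂ Ec O ∧
          (∀ z ∈ O, ‖Ec z‖ ≤ E₀ * Real.exp (-(κ * torusTreeLen Y.1))) ∧
          (∀ t ∈ Ioc (0 : ℝ) γ, Ec t = termC S j Y (Function.update g i t) ψ)) →
      ∃ (Hc : ℂ → TDom 4 (domCount (F.P K) M (k + 1)) → ℂ)
        (Tt : (Z : TDom 4 (domCount (F.P K) M (k + 1))) →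
          Finset (TDom 4 (L * domCount (F.P K) M (k + 1))) × Finset (TBond 4 M (L * domCount (F.P K) M (k + 1))) → ℂ → ℂ)
        (O : Set ℂ), IsOpen O ∧ (∀ t ∈ Ioc (0 : ℝ) γ, closedBall (t : ℂ) r ⊆ O) ∧
        (∀ Z : (domSys (F.P K) M (k + 1)).Dom, Z.1 ⊆ X.1 → DifferentiableOn ℂ (fun z => Hc z Z) O) ∧
        (∀ z ∈ O, ∀ Z : TDom 4 (domCount (F.P K) M (k + 1)), Z.1 ⊆ X.1 → ‖Hc z Z‖ ≤ ∑ t ∈ terms L M Z, ‖Tt Z t z‖) ∧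
        (∀ z ∈ O, ∀ Z : TDom 4 (domCount (F.P K) M (k + 1)), Z.1 ⊆ X.1 → ∀ t ∈ terms L M Z,
          ‖Tt Z t z‖ ≤ weight L M c Z a t * Real.exp (a₅ * ((Z.1).card : ℝ))) ∧
        (∀ t ∈ Ioc (0 : ℝ) γ, Hc t = (S k).H (restrictPrefix k (Function.update g i t)) φ))
    (hlast : ∀ (k : ℕ) (g : ℕ → ℝ), g ∈ Window γ → ∀ (X : (domSys (F.P K) M (k + 1)).Dom) (φ : CPair (F.P K) 𝔸), φ ∈ sp (k + 1) X →
      (∀ (j : ℕ), j < k + 1 → ∀ (Y : (domSys (F.P K) M j).Dom) (ψ : CPair (F.P K) 𝔸), ψ ∈ sp j Y →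
        ∃ (Ec : ℂ → ℂ) (O : Set ℂ), IsOpen O ∧ (∀ t ∈ Ioc (0 : ℝ) γ, closedBall (t : ℂ) r ⊆ O) ∧ DifferentiableOn ℂ Ec O ∧
          (∀ z ∈ O, ‖Ec z‖ ≤ E₀ * Real.exp (-(κ * torusTreeLen Y.1))) ∧
          (∀ t ∈ Ioc (0 : ℝ) γ, Ec t = termC S j Y (Function.update g k t) ψ)) →
      ∃ (Ec : ℂ → ℂ) (O : Set ℂ), IsOpen O ∧ (∀ t ∈ Ioc (0 : ℝ) γ, closedBall (t : ℂ) r ⊆ O) ∧ DifferentiableOn ℂ Ec O ∧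
        (∀ z ∈ O, ‖Ec z‖ ≤ E₀ * Real.exp (-(κ * torusTreeLen X.1))) ∧
        (∀ t ∈ Ioc (0 : ℝ) γ, Ec t = termC S (k + 1) X (Function.update g k t) φ)) :
    TermBound118 S (Window γ) sp E₀ κ :=
  termBound118_of_stripBound S sp hr
    (stripBound_termC_of_termwise226StripOlder_lastOut F K S sp c hL hLc hN hr hA0 hr₁ hκ hrate hsmall hrenew h226TOlder hlast)

open Classical in
/-- **MIXED LEVEL T ⟹ ROAD 3's (A) LETTER FOR THE W1 FUNCTIONAL** (readings inside the spaces; module 2's `supLetter_functionalOn_of_stripBound`): the `hA` clause with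
`M := E₀`, `μ := 1`. [folklore] -/
theorem supLetter_functionalOn_of_termwise226StripOlder_lastOut [NeZero M] (S : ClusterTower (F.P K) 𝔸 M) (p : RunPairing) {B : Type}
    (emb : B → CPair (F.P K) 𝔸) (sp : (j : ℕ) → (domSys (F.P K) M j).Dom → Set (CPair (F.P K) 𝔸))
    (hsp : ∀ (j : ℕ) (U : B) (Y : (domSys (F.P K) M j).Dom), emb U ∈ sp j Y) (c : B13.Consts) {L : ℕ} [NeZero L]
    (hL : 8 ≤ c.L) (hLc : c.L = L) {a a₂ a₂' a₅ Aabs : ℝ} (hN : Lemma3Numerics c M ((c.L : ℝ) / 2) a a₂ a₂' a₅ Aabs)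
    {γ r E₀ κ r₁ : ℝ} (hr : 0 ≤ r) (hA0 : 0 ≤ c.C3act * c.ε₁) (hr₁ : 0 ≤ r₁) (hκ : κ ≤ r₁)
    (hrate : r₁ + 2 * (64 * Real.log 162) + 2 ≤ (1 - 8 * c.δ) * ((c.L : ℝ) / 2) * c.κ)
    (hsmall : c.C3act * c.ε₁ * Real.exp (5 * r₁ + 1) * K₀ 64 8 * 9 * 64 ≤ 1)
    (hrenew : Real.exp 1 * 9 * 64 * K₀ 64 8 ^ 2 * (c.C3act * c.ε₁) ≤ E₀)
    (h226TOlder : ∀ (k : ℕ) (g : ℕ → ℝ), g ∈ Window γ → ∀ (i : ℕ), i < k → ∀ (X : (domSys (F.P K) M (k + 1)).Dom) (φ : CPair (F.P K) 𝔸),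
      φ ∈ sp (k + 1) X →
      (∀ (j : ℕ), j < k + 1 → ∀ (Y : (domSys (F.P K) M j).Dom) (ψ : CPair (F.P K) 𝔸), ψ ∈ sp j Y →
        ∃ (Ec : ℂ → ℂ) (O : Set ℂ), IsOpen O ∧ (∀ t ∈ Ioc (0 : ℝ) γ, closedBall (t : ℂ) r ⊆ O) ∧ DifferentiableOn ℂ Ec O ∧
          (∀ z ∈ O, ‖Ec z‖ ≤ E₀ * Real.exp (-(κ * torusTreeLen Y.1))) ∧
          (∀ t ∈ Ioc (0 : ℝ) γ, Ec t = termC S j Y (Function.update g i t) ψ)) →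
      ∃ (Hc : ℂ → TDom 4 (domCount (F.P K) M (k + 1)) → ℂ)
        (Tt : (Z : TDom 4 (domCount (F.P K) M (k + 1))) →
          Finset (TDom 4 (L * domCount (F.P K) M (k + 1))) × Finset (TBond 4 M (L * domCount (F.P K) M (k + 1))) → ℂ → ℂ)
        (O : Set ℂ), IsOpen O ∧ (∀ t ∈ Ioc (0 : ℝ) γ, closedBall (t : ℂ) r ⊆ O) ∧
        (∀ Z : (domSys (F.P K) M (k + 1)).Dom, Z.1 ⊆ X.1 → DifferentiableOn ℂ (fun z => Hc z Z) O) ∧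
        (∀ z ∈ O, ∀ Z : TDom 4 (domCount (F.P K) M (k + 1)), Z.1 ⊆ X.1 → ‖Hc z Z‖ ≤ ∑ t ∈ terms L M Z, ‖Tt Z t z‖) ∧
        (∀ z ∈ O, ∀ Z : TDom 4 (domCount (F.P K) M (k + 1)), Z.1 ⊆ X.1 → ∀ t ∈ terms L M Z,
          ‖Tt Z t z‖ ≤ weight L M c Z a t * Real.exp (a₅ * ((Z.1).card : ℝ))) ∧
        (∀ t ∈ Ioc (0 : ℝ) γ, Hc t = (S k).H (restrictPrefix k (Function.update g i t)) φ))
    (hlast : ∀ (k : ℕ) (g : ℕ → ℝ), g ∈ Window γ → ∀ (X : (domSys (F.P K) M (k + 1)).Dom) (φ : CPair (F.P K) 𝔸), φ ∈ sp (k + 1) X →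
      (∀ (j : ℕ), j < k + 1 → ∀ (Y : (domSys (F.P K) M j).Dom) (ψ : CPair (F.P K) 𝔸), ψ ∈ sp j Y →
        ∃ (Ec : ℂ → ℂ) (O : Set ℂ), IsOpen O ∧ (∀ t ∈ Ioc (0 : ℝ) γ, closedBall (t : ℂ) r ⊆ O) ∧ DifferentiableOn ℂ Ec O ∧
          (∀ z ∈ O, ‖Ec z‖ ≤ E₀ * Real.exp (-(κ * torusTreeLen Y.1))) ∧
          (∀ t ∈ Ioc (0 : ℝ) γ, Ec t = termC S j Y (Function.update g k t) ψ)) →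
      ∃ (Ec : ℂ → ℂ) (O : Set ℂ), IsOpen O ∧ (∀ t ∈ Ioc (0 : ℝ) γ, closedBall (t : ℂ) r ⊆ O) ∧ DifferentiableOn ℂ Ec O ∧
        (∀ z ∈ O, ‖Ec z‖ ≤ E₀ * Real.exp (-(κ * torusTreeLen X.1))) ∧
        (∀ t ∈ Ioc (0 : ℝ) γ, Ec t = termC S (k + 1) X (Function.update g k t) φ)) :
    ∀ g ∈ Window γ, ∀ (U : B) (X : (histCarriers (F.P K) M p).Dom) (i : ℕ), i < (histCarriers (F.P K) M p).scale X →
      ∃ (Fz : ℂ → ℂ) (Dset : Set ℂ), DifferentiableOn ℂ Fz Dset ∧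
        (∀ z ∈ Dset, ‖Fz z‖ ≤ E₀ * 1 ^ ((histCarriers (F.P K) M p).scale X - 1 - i) *
          Real.exp (-(κ * (histCarriers (F.P K) M p).d X))) ∧
        (∀ t ∈ Ioc (0 : ℝ) γ, closedBall (t : ℂ) r ⊆ Dset) ∧
        (∀ t ∈ Ioc (0 : ℝ) γ, Fz t = (functionalOn S p emb (Function.update g i t) U X : ℂ)) :=
  supLetter_functionalOn_of_stripBound S p emb sp hsp
    (stripBound_termC_of_termwise226StripOlder_lastOut F K S sp c hL hLc hN hr hA0 hr₁ hκ hrate hsmall hrenew h226TOlder hlast)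

end YMDAG.N22.W1

end
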